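import Summits.QuantumFields.BalabanUV.T4Continuum.Spine.NE2.DeltaPrimeOperator
import Summits.QuantumFields.BalabanUV.T4Continuum.Support.ComponentSwapShift
import Summits.QuantumFields.BalabanUV.T4Continuum.Support.BlockPairingGeometry

/-!
# T⁴ programme, spine node NE2 (U1a) — THE ZEROTH-ORDER BLOCK OF (3.10)'s `Δ′` IS A FINITE SUM OF CATALOGUE TERMS, and its `PerturbationLaws` from
# bounded, two-level consistent plaquette fields (repair R13, file 2; residual r1 of the dictionary B0)

Cell `pub-balaban-gaps` (track G2, seat ne2 = spine estimate NE2; census `run/shared/lean/pub/pub-balaban-gaps/ne/NE2.md` §5 R13, plan `ne/NE2-R13-PLAN.md`).  File 1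
(`Spine/NE2/DeltaPrimeOperator`) typed [Balaban1985BackgroundPropagators] (3.10)'s curvature part `Δ′` as an operator on ROOT B's carriers: per plaquette `p_{μν}(x)` a
second-order block `plaqBlock₁` and the commutator block `plaqBlock₂ = Σ_{j<j′} ½(edgeM jᵀ·brkF(cη² Im U(∂p))·edgeM j′ + transpose)` built from the four transported edge
evaluations `edgeM j` of p.390 (3.2).  THIS FILE puts the commutator block into the tree's catalogue of perturbation shapes and derives its laws:
 * §1 **`sum_pairTerm_eq`** (generic): `Σ_x (tproj Rl(x) (x+δl, κl))ᵀ·B(x)·tproj Rr(x) (x+δr, κr) = siteMul (pairField Rl B Rr δl κl)·((Π_{κl κr}·T_{δr−δl}) ⊗ 1)` — a colour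
   field on the slot `κl` (`pairField`: `Rl(x)ᵀB(x)Rr(x)` read at `x = y − δl`) times the component transposition `Π` of `ComponentSwapShift.swapT` times the lattice
   translation `BalabanBlockPoincare.transl`;
 * §2 the edge maps as transported evaluations (`edgeR`, `edgeOff`, `edgeSlot`, **`edgeM_eq_tproj`**) and **`sum_plaqBlock₂_eq`**: summed over base points, the commutator
   block of the `(μ,ν)`-plaquettes is `Σ_{j<j′} ½[siteMul(z_{jj′})·((Π·T_{δ_j′−δ_j}) ⊗ 1) + siteMul(z′_{jj′})·((Π·T_{δ_j−δ_j′}) ⊗ 1)]` with offsets in `{0, ±e_μ, ±e_ν, ±(e_μ−e_ν)}`;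
 * §3 ALONG THE TOWER (`Nf = fine (L^k) M`, `cη = L^k`): **`shiftLaws_edgeTransl`** (every edge-offset translation is one of the carriers `1`, `S⊗1`, `Sᴴ⊗1`, `SᴴS′⊗1` of
   `ShiftedZerothOrder`, hence obeys `ShiftLaws` with constant `2Cst`), the field towers `zF`/`zB`, **`deltaPrime₂`** (`= Σ_x Σ_{μ<ν} plaqBlock₂` at level `k`), `deltaPrime₂_eq`,
   and **`perturbationLaws_deltaPrime₂`**: `BoundedBackgroundM` of every `zF`, `zB` (size `α`, block-parent consistency `β/L^k`) ⟹
   `PerturbationLaws (Δ_a⊗1) deltaPrime₂ (J⊗1) κ (C·L^{−k})` with the explicit finite-sum constants of `ComponentSwapShift.perturbationLaws_siteMul_swap_mul`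
   (`KroneckerUnits.perturbationLaws_finsetSum`, `PerturbationAlgebra.perturbationLaws_smul/add`);
 * §4 SIZE of the catalogue fields: **`norm_zF_zB_le`** — for a unitary bond-field tower and a trace-orthonormal family (`CompFamily`), `‖B_k(x)‖ ≤ b ⟹ ‖zF‖, ‖zB‖ ≤ b`
   (`edgeR` and its transpose are contractions: `norm_edgeR_le_one`); the two-level CONSISTENCY half of `BoundedBackgroundM` is NOT derived here.
LEFT (R13 file 3): the second-order block `plaqBlock₁` (`GradComm` + [B5] (1.89)) and the CONSISTENCY FEED for `zF/zB` (template `HolonomyTowerRegular.boundedBackgroundM_holTower`).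

HONEST FRAMING (T4-DAG p. 1).  [folklore] finite-dimensional algebra + the tree's catalogue laws at MODEL LEVEL: the bond fields `V`, the component family `e`, `c` are DATA;
`BoundedBackgroundM` of the catalogue fields is a DISPLAYED hypothesis structure (nothing printed is a hypothesis or a conclusion); no claim that `V` is Bałaban's
minimiser; NOT (3.10) «bounded, small» as printed; NE2 (U1a) NOT PROVED; spine PROVED 0/9 unchanged; NOT continuum YM / infinite volume / mass gap / Clay.  HONEST
DEPENDENCY: continuum YM on T⁴ ⇐ BetaPertH ∧ nine spine estimates (0/9 proved); BetaPertH ⇐ (D1) ∧ (D4) ∧ CAP+tail; G-an2-4 gates asym, D1 and NE2/3/4.  No `sorry`.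
-/

noncomputable section

open scoped BigOperators ComplexConjugate Matrix

namespace Summit.QuantumFields.BalabanUV.T4Continuum.NE2.DeltaPrimeCatalogue

open scoped Kronecker Matrix.Norms.L2Operator
open Literature.MathematicalPhysics.QuantumFieldTheory.Balaban1983to89.B5Prop11Plancherel (fine Cst Cst_nonneg)
open Literature.MathematicalPhysics.QuantumFieldTheory.Balaban1983to89.B5G183RateUnitTower (lev lev_neZero)
open Summit.QuantumFields.BalabanUV.T4Continuum.BalabanAveragedTowerUnit (idx)

open Literature.MathematicalPhysics.QuantumFieldTheory.Balaban1983to89.B5Prop11Plancherel (Tor unitVec shiftM)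
open Summit.QuantumFields.BalabanUV.T4Continuum.BlockMultiplication (siteMul siteMul_apply siteMul_mul_kron_apply)
open Summit.QuantumFields.BalabanUV.T4Continuum.ComponentSwapShift (swapT swapT_apply)
open Summit.QuantumFields.BalabanUV.T4Continuum.BalabanBlockPoincare (transl transl_zero transl_add shiftM_eq_transl)
open Summit.QuantumFields.BalabanUV.T4Continuum.BlockPairingGeometry (conjTranspose_transl)
open Summit.QuantumFields.BalabanUV.T4Continuum.NE2.DeltaPrimeOperator
open Summit.QuantumFields.BalabanUV.Beta.AdjointCarrierWiring (adMat)

variable {n : Type} [Fintype n] [DecidableEq n] {d : ℕ} (Nf : Fin d → ℕ) [hNf : ∀ μ, NeZero (Nf μ)] {ι : Type} [Fintype ι] [DecidableEq ι]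

/-- **the catalogue colour field of a pair term**: on the slot `κl`, at site `y`, the matrix `Rl(x)ᵀ·B(x)·Rr(x)` read at `x = y − δl`; zero on other slots.
[folklore] -/
def pairField (Rl B Rr : Tor Nf → Matrix ι ι ℂ) (δl : Tor Nf) (κl : Fin d) : Tor Nf × Fin d → Matrix ι ι ℂ :=
  fun i => if i.2 = κl then (Rl (i.1 - δl))ᵀ * B (i.1 - δl) * Rr (i.1 - δl) else 0

/-- entries of the slot-transposition-times-translation carrier: `(Π_{κl κr}·T_δ) (y,κ) (y′,κ′) = [κ = κl]·[(y′,κ′) = (y + δ, κr)]`. [folklore] -/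
theorem swapT_mul_transl_apply (κl κr : Fin d) (δ : Tor Nf) (i j : Tor Nf × Fin d) :
    (swapT Nf κl κr * transl Nf δ) i j = if i.2 = κl ∧ j = (i.1 + δ, κr) then 1 else 0 := by
  rw [Matrix.mul_apply, Finset.sum_eq_single (i.1, κr)]
  · rw [swapT_apply]
    simp only [transl]
    by_cases h : i.2 = κl
    · simp [h]
    · simp [h]
  · intro m _ hm
    rw [swapT_apply, if_neg (fun h => hm h.2), zero_mul]
  · intro h; exact absurd (Finset.mem_univ _) h

omit hNf [Fintype ι] [DecidableEq ι] in
/-- entries of `tproj` at an explicit index pair. [folklore] -/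
theorem tproj_apply_mk (R : Matrix ι ι ℂ) (b i : Tor Nf × Fin d) (k l : ι) : tproj Nf R b k (i, l) = if i = b then R k l else 0 := rfl

omit hNf [DecidableEq ι] in
/-- entries of one pair term at one plaquette base point `x`. [folklore] -/
theorem pairTerm_apply (Rl B Rr : Tor Nf → Matrix ι ι ℂ) (δl δr : Tor Nf) (κl κr : Fin d) (x : Tor Nf) (i j : Tor Nf × Fin d) (k l : ι) :
    ((tproj Nf (Rl x) (x + δl, κl))ᵀ * B x * tproj Nf (Rr x) (x + δr, κr)) (i, k) (j, l)
      = if i = (x + δl, κl) ∧ j = (x + δr, κr) then ((Rl x)ᵀ * B x * Rr x) k l else 0 := by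
  simp only [Matrix.mul_apply, Matrix.transpose_apply, tproj_apply_mk]
  by_cases h1 : i = (x + δl, κl)
  · by_cases h2 : j = (x + δr, κr)
    · simp only [h1, h2, if_true, and_self]
    · simp [h2]
  · simp [h1]

/-- **THE GENERIC PAIR TERM IS A CATALOGUE TERM**: `Σ_x (tproj Rl(x) (x+δl, κl))ᵀ · B(x) · tproj Rr(x) (x+δr, κr) =
siteMul (pairField Rl B Rr δl κl) · ((Π_{κl κr} · T_{δr − δl}) ⊗ 1)` — a bounded colour field on the slot `κl` times the component transposition
`Π_{κl κr}` times the lattice translation by `δr − δl` (the shape of `ShiftedZerothOrder` / `ComponentSwapShift`). [folklore] -/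
theorem sum_pairTerm_eq (Rl B Rr : Tor Nf → Matrix ι ι ℂ) (δl δr : Tor Nf) (κl κr : Fin d) :
    ∑ x, (tproj Nf (Rl x) (x + δl, κl))ᵀ * B x * tproj Nf (Rr x) (x + δr, κr)
      = siteMul (pairField Nf Rl B Rr δl κl) * (swapT Nf κl κr * transl Nf (δr - δl)) ⊗ₖ (1 : Matrix ι ι ℂ) := by
  ext ⟨i, k⟩ ⟨j, l⟩
  rw [siteMul_mul_kron_apply, Matrix.sum_apply, swapT_mul_transl_apply]
  simp only [pairTerm_apply, pairField]
  by_cases h : i.2 = κl ∧ j = (i.1 + (δr - δl), κr)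
  · obtain ⟨hκ, hj⟩ := h
    rw [if_pos hκ, if_pos (show i.2 = κl ∧ j = (i.1 + (δr - δl), κr) from ⟨hκ, hj⟩), mul_one, Finset.sum_eq_single (i.1 - δl)]
    · rw [if_pos]
      refine ⟨Prod.ext (by simp) hκ, ?_⟩
      rw [hj, Prod.mk.injEq]
      exact ⟨by abel, rfl⟩
    · intro x _ hx
      rw [if_neg]
      rintro ⟨hi, -⟩
      exact hx (by rw [hi]; simp)
    · intro hh; exact absurd (Finset.mem_univ _) hh
  · rw [if_neg h, mul_zero]
    refine Finset.sum_eq_zero fun x _ => ?_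
    rw [if_neg]
    rintro ⟨hi, hj⟩
    refine h ⟨by rw [hi], ?_⟩
    rw [hj, hi, Prod.mk.injEq]
    exact ⟨by simp only; abel, rfl⟩

/-! ## The edge maps as transported evaluations and the decomposition of the zeroth-order block -/
section Decomposition

variable (cη : ℝ) (c : ℝ) (e : ι → Matrix n n ℂ)

/-- the colour matrix of the edge `j` of `∂(p_{μν}(x))_z` with its (3.5)-sign absorbed: `−R(U_ν(x))`, `−1`, `1`, `R(U_μ(x))`. [folklore] -/
def edgeR (V : Fin d → Tor Nf → Matrix n n ℂ) (x : Tor Nf) (μ ν : Fin d) (j : Fin 4) : Matrix ι ι ℂ :=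
  match j with
  | 0 => -(adMat c e (V ν x)).map ((↑) : ℝ → ℂ)
  | 1 => -1
  | 2 => 1
  | 3 => (adMat c e (V μ x)).map ((↑) : ℝ → ℂ)

/-- the site offset of the edge `j` from the base point `x`: `e_ν`, `0`, `0`, `e_μ`. [folklore] -/
def edgeOff (μ ν : Fin d) (j : Fin 4) : Tor Nf :=
  match j with
  | 0 => unitVec Nf ν
  | 1 => 0
  | 2 => 0
  | 3 => unitVec Nf μ

omit hNf in
/-- the component slot of the edge `j`: `μ`, `ν`, `μ`, `ν`. [folklore] -/
def edgeSlot (μ ν : Fin d) (j : Fin 4) : Fin d :=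
  match j with
  | 0 => μ
  | 1 => ν
  | 2 => μ
  | 3 => ν

omit hNf [Fintype n] [DecidableEq n] [Fintype ι] [DecidableEq ι] in
/-- `tproj` is additive-homogeneous in the colour matrix: `tproj (−R) b = −tproj R b`. [folklore] -/
theorem tproj_neg (R : Matrix ι ι ℂ) (b : Tor Nf × Fin d) : tproj Nf (-R) b = -tproj Nf R b := by
  ext k q
  simp only [tproj, Matrix.neg_apply]
  split_ifs <;> simp

omit hNf [Fintype ι] in
/-- **every edge map is a transported evaluation** `edgeM j = tproj (edgeR j) (x + edgeOff j, edgeSlot j)`. [folklore] -/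
theorem edgeM_eq_tproj (V : Fin d → Tor Nf → Matrix n n ℂ) (x : Tor Nf) (μ ν : Fin d) (j : Fin 4) :
    edgeM Nf c e V x μ ν j = tproj Nf (edgeR Nf c e V x μ ν j) (x + edgeOff Nf μ ν j, edgeSlot μ ν j) := by
  fin_cases j
  · exact (tproj_neg Nf _ _).symm
  · show -tproj Nf 1 (x, ν) = tproj Nf (-1) (x + 0, ν)
    rw [add_zero, tproj_neg]
  · show tproj Nf 1 (x, μ) = tproj Nf 1 (x + 0, μ)
    rw [add_zero]
  · rfl

/-- the plaquette colour matrix of the commutator block: `B(x) = brkF(cη²·Im U(∂p_{μν}(x)))`. [folklore] -/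
def Bfield (V : Fin d → Tor Nf → Matrix n n ℂ) (μ ν : Fin d) (x : Tor Nf) : Matrix ι ι ℂ :=
  brkF c e ((((cη : ℂ)) ^ 2) • imHol Nf V x μ ν)

/-- **THE ZEROTH-ORDER BLOCK OF `Δ′` IS A FINITE SUM OF CATALOGUE TERMS**: summed over the base points `x`, the commutator block of the
`(μ, ν)`-plaquettes is `Σ_{j<j′} ½·[ siteMul(z_{jj′})·((Π_{κ_j κ_j′}·T_{δ_j′−δ_j}) ⊗ 1) + siteMul(z′_{jj′})·((Π_{κ_j′ κ_j}·T_{δ_j−δ_j′}) ⊗ 1) ]` with the colour fields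
`z_{jj′} = pairField (edgeR j) B (edgeR j′) δ_j κ_j`, `z′_{jj′} = pairField (edgeR j′) Bᵀ (edgeR j) δ_j′ κ_j′` and translations by `0, ±e_μ, ±e_ν, ±(e_μ − e_ν)` — the carriers
`1`, `S_λ ⊗ 1`, `S_λᴴ ⊗ 1`, `S_μᴴS_ν ⊗ 1` of `ShiftedZerothOrder`/`ComponentSwapShift` (`shiftM_eq_transl`, `conjTranspose_transl`, `transl_add`).  What remains for the
`PerturbationLaws` (R13 file 2) is `BoundedBackgroundM` of these fields from the plaquette data. [folklore] -/
theorem sum_plaqBlock₂_eq (V : Fin d → Tor Nf → Matrix n n ℂ) (μ ν : Fin d) :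
    ∑ x, plaqBlock₂ Nf cη c e V x μ ν
      = ∑ jj ∈ orderedPairs, (1 / 2 : ℂ) •
          (siteMul (pairField Nf (fun x => edgeR Nf c e V x μ ν jj.1) (Bfield Nf cη c e V μ ν) (fun x => edgeR Nf c e V x μ ν jj.2)
              (edgeOff Nf μ ν jj.1) (edgeSlot μ ν jj.1))
            * (swapT Nf (edgeSlot μ ν jj.1) (edgeSlot μ ν jj.2) * transl Nf (edgeOff Nf μ ν jj.2 - edgeOff Nf μ ν jj.1)) ⊗ₖ (1 : Matrix ι ι ℂ)
          + siteMul (pairField Nf (fun x => edgeR Nf c e V x μ ν jj.2) (fun x => (Bfield Nf cη c e V μ ν x)ᵀ) (fun x => edgeR Nf c e V x μ ν jj.1)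
              (edgeOff Nf μ ν jj.2) (edgeSlot μ ν jj.2))
            * (swapT Nf (edgeSlot μ ν jj.2) (edgeSlot μ ν jj.1) * transl Nf (edgeOff Nf μ ν jj.1 - edgeOff Nf μ ν jj.2)) ⊗ₖ (1 : Matrix ι ι ℂ)) := by
  simp only [plaqBlock₂]
  rw [Finset.sum_comm]
  refine Finset.sum_congr rfl fun jj _ => ?_
  rw [← Finset.smul_sum, Finset.sum_add_distrib]
  congr 1
  simp only [edgeM_eq_tproj, Matrix.transpose_mul, Matrix.transpose_transpose, Matrix.mul_assoc]
  rw [← sum_pairTerm_eq, ← sum_pairTerm_eq]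
  simp only [Bfield, Matrix.mul_assoc]

end Decomposition

/-! ## Along the tower: `PerturbationLaws` for the zeroth-order block from bounded, two-level consistent plaquette fields -/

section Tower

open Summit.QuantumFields.BalabanUV.T4Continuum.BackgroundResolventTower (PerturbationLaws)
open Summit.QuantumFields.BalabanUV.T4Continuum.TransportedSiteAveraging (Dc Jc)
open Summit.QuantumFields.BalabanUV.T4Continuum.ShiftedZerothOrder (ShiftLaws Sfwd Sbwd Smix shiftLaws_one shiftLaws_fwd shiftLaws_bwd shiftLaws_mixed)
open Summit.QuantumFields.BalabanUV.T4Continuum.ComponentSwapShift (cSwap perturbationLaws_siteMul_swap_mul)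
open Summit.QuantumFields.BalabanUV.T4Continuum.ColourCovariantLaplacian (BoundedBackgroundM)
open Summit.QuantumFields.BalabanUV.T4Continuum.PerturbationAlgebra (perturbationLaws_add perturbationLaws_smul perturbationLaws_mono)
open Summit.QuantumFields.BalabanUV.T4Continuum.KroneckerUnits (perturbationLaws_finsetSum)
open Summit.QuantumFields.BalabanUV.T4Continuum.KroneckerLift (kron_mul kron_conjTranspose)

variable (L : ℕ) [NeZero L] (M : Fin d → ℕ) [hM : ∀ μ, NeZero (M μ)] (a : ℝ) (ha : 0 < a) (c : ℝ) (e : ι → Matrix n n ℂ)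

/-- `ShiftLaws` is monotone in its constant. [folklore] -/
theorem shiftLaws_mono {T : (k : ℕ) → Matrix (idx L M k × ι) (idx L M k × ι) ℂ} {ct ct' : ℝ} (h : ShiftLaws L M a ha T ct) (hle : ct ≤ ct') :
    ShiftLaws L M a ha T ct' where
  nonneg := h.nonneg.trans hle
  opNorm_le := h.opNorm_le
  intertwine_le := fun k => (h.intertwine_le k).trans (div_le_div_of_nonneg_right hle (Nat.cast_nonneg _))

/-- **THE EDGE-OFFSET TRANSLATIONS OBEY `ShiftLaws`** (constant `2Cst`): the offsets `δ_j′ − δ_j ∈ {0, ±e_μ, ±e_ν, ±(e_μ − e_ν)}` give the carriers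
`1`, `S ⊗ 1`, `Sᴴ ⊗ 1`, `SᴴS′ ⊗ 1` of `ShiftedZerothOrder` (`transl_zero`, `shiftM_eq_transl`, `conjTranspose_transl`, `transl_add`). [folklore] -/
theorem shiftLaws_edgeTransl (μ ν : Fin d) (j j' : Fin 4) :
    ShiftLaws L M a ha (fun k => transl (fine (lev L k) M) (edgeOff (fine (lev L k) M) μ ν j' - edgeOff (fine (lev L k) M) μ ν j) ⊗ₖ (1 : Matrix ι ι ℂ))
      (2 * Cst d a) := by
  have hC : 0 ≤ Cst d a := Cst_nonneg d a
  have h2 : Cst d a ≤ 2 * Cst d a := by linarith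
  have h0 : (0 : ℝ) ≤ 2 * Cst d a := by linarith
  -- the four carrier identities, uniformly in the level
  have e0 : ∀ k, transl (fine (lev L k) M) (0 : Tor (fine (lev L k) M)) ⊗ₖ (1 : Matrix ι ι ℂ) = 1 := fun k => by
    rw [transl_zero, Matrix.one_kronecker_one]
  have ef : ∀ k (lam : Fin d), transl (fine (lev L k) M) (unitVec (fine (lev L k) M) lam) ⊗ₖ (1 : Matrix ι ι ℂ) = Sfwd L M lam k := fun k lam => by
    rw [Sfwd, shiftM_eq_transl]
  have eb : ∀ k (lam : Fin d), transl (fine (lev L k) M) (-unitVec (fine (lev L k) M) lam) ⊗ₖ (1 : Matrix ι ι ℂ) = Sbwd L M lam k := fun k lam => by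
    rw [Sbwd, shiftM_eq_transl, conjTranspose_transl]
  have em : ∀ k (lam₁ lam₂ : Fin d), transl (fine (lev L k) M) (unitVec (fine (lev L k) M) lam₁ - unitVec (fine (lev L k) M) lam₂) ⊗ₖ (1 : Matrix ι ι ℂ)
      = Smix L M lam₂ lam₁ k := fun k lam₁ lam₂ => by
    rw [Smix, sub_eq_neg_add, transl_add, ← conjTranspose_transl]
    rfl
  fin_cases j <;> fin_cases j'
  all_goals simp only [edgeOff, sub_zero, zero_sub, sub_self]
  · simp only [e0]; exact shiftLaws_mono L M a ha (shiftLaws_one L M a ha) h0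
  · simp only [eb]; exact shiftLaws_mono L M a ha (shiftLaws_bwd L M a ha ν) h2
  · simp only [eb]; exact shiftLaws_mono L M a ha (shiftLaws_bwd L M a ha ν) h2
  · simp only [em]; exact shiftLaws_mixed L M a ha ν μ
  · simp only [ef]; exact shiftLaws_mono L M a ha (shiftLaws_fwd L M a ha ν) h2
  · simp only [e0]; exact shiftLaws_mono L M a ha (shiftLaws_one L M a ha) h0
  · simp only [e0]; exact shiftLaws_mono L M a ha (shiftLaws_one L M a ha) h0
  · simp only [ef]; exact shiftLaws_mono L M a ha (shiftLaws_fwd L M a ha μ) h2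
  · simp only [ef]; exact shiftLaws_mono L M a ha (shiftLaws_fwd L M a ha ν) h2
  · simp only [e0]; exact shiftLaws_mono L M a ha (shiftLaws_one L M a ha) h0
  · simp only [e0]; exact shiftLaws_mono L M a ha (shiftLaws_one L M a ha) h0
  · simp only [ef]; exact shiftLaws_mono L M a ha (shiftLaws_fwd L M a ha μ) h2
  · simp only [em]; exact shiftLaws_mixed L M a ha μ ν
  · simp only [eb]; exact shiftLaws_mono L M a ha (shiftLaws_bwd L M a ha μ) h2
  · simp only [eb]; exact shiftLaws_mono L M a ha (shiftLaws_bwd L M a ha μ) h2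
  · simp only [e0]; exact shiftLaws_mono L M a ha (shiftLaws_one L M a ha) h0

variable (V : (k : ℕ) → Fin d → Tor (fine (lev L k) M) → Matrix n n ℂ)

/-- the FORWARD catalogue field tower of the pair `(j, j′)` at the `(μ, ν)`-plaquettes (`pairField (edgeR j) B (edgeR j′) δ_j κ_j` at level `k`). [folklore] -/
def zF (μ ν : Fin d) (jj : Fin 4 × Fin 4) (k : ℕ) : idx L M k → Matrix ι ι ℂ :=
  pairField (fine (lev L k) M) (fun x => edgeR (fine (lev L k) M) c e (V k) x μ ν jj.1) (Bfield (fine (lev L k) M) (lev L k) c e (V k) μ ν)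
    (fun x => edgeR (fine (lev L k) M) c e (V k) x μ ν jj.2) (edgeOff (fine (lev L k) M) μ ν jj.1) (edgeSlot μ ν jj.1)

/-- the BACKWARD (transposed-partner) catalogue field tower of the pair `(j, j′)`. [folklore] -/
def zB (μ ν : Fin d) (jj : Fin 4 × Fin 4) (k : ℕ) : idx L M k → Matrix ι ι ℂ :=
  pairField (fine (lev L k) M) (fun x => edgeR (fine (lev L k) M) c e (V k) x μ ν jj.2) (fun x => (Bfield (fine (lev L k) M) (lev L k) c e (V k) μ ν x)ᵀ)
    (fun x => edgeR (fine (lev L k) M) c e (V k) x μ ν jj.1) (edgeOff (fine (lev L k) M) μ ν jj.2) (edgeSlot μ ν jj.2)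

/-- **THE ZEROTH-ORDER (COMMUTATOR) BLOCK OF `Δ′` ALONG THE TOWER**: `Δ′₂^{(k)} = Σ_x Σ_{μ<ν} plaqBlock₂` at spacing `L^{−k}` (`cη = L^k`). [folklore] -/
def deltaPrime₂ (k : ℕ) : Matrix (idx L M k × ι) (idx L M k × ι) ℂ :=
  ∑ x, ∑ q ∈ dirPairs d, plaqBlock₂ (fine (lev L k) M) (lev L k) c e (V k) x q.1 q.2

/-- the block as a sum over direction pairs and edge pairs of the two catalogue terms (`sum_plaqBlock₂_eq`, tower form). [folklore] -/
theorem deltaPrime₂_eq (k : ℕ) :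
    deltaPrime₂ L M c e V k = ∑ q ∈ dirPairs d, ∑ jj ∈ orderedPairs, (1 / 2 : ℂ) •
      (siteMul (zF L M c e V q.1 q.2 jj k)
          * (cSwap L M (o := ι) (edgeSlot q.1 q.2 jj.1) (edgeSlot q.1 q.2 jj.2) k
            * transl (fine (lev L k) M) (edgeOff (fine (lev L k) M) q.1 q.2 jj.2 - edgeOff (fine (lev L k) M) q.1 q.2 jj.1) ⊗ₖ (1 : Matrix ι ι ℂ))
        + siteMul (zB L M c e V q.1 q.2 jj k)
          * (cSwap L M (o := ι) (edgeSlot q.1 q.2 jj.2) (edgeSlot q.1 q.2 jj.1) k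
            * transl (fine (lev L k) M) (edgeOff (fine (lev L k) M) q.1 q.2 jj.1 - edgeOff (fine (lev L k) M) q.1 q.2 jj.2) ⊗ₖ (1 : Matrix ι ι ℂ))) := by
  rw [deltaPrime₂, Finset.sum_comm]
  refine Finset.sum_congr rfl fun q _ => ?_
  rw [show ((lev L k : ℕ) : ℝ) = ((lev L k : ℕ) : ℝ) from rfl, sum_plaqBlock₂_eq]
  refine Finset.sum_congr rfl fun jj _ => ?_
  simp only [zF, zB, cSwap, kron_mul]

/-- **`PerturbationLaws` FOR THE ZEROTH-ORDER BLOCK OF `Δ′`** from bounded, two-level consistent catalogue fields: if every pair field tower `zF`, `zB` lies in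
`BoundedBackgroundM … α β` (size `α`, block-parent consistency `β/L^k` — the (3.35)-shape on `η⁻² Im U(∂p)` and node NE3's currency, to be fed in R13 file 3), then
`Δ′₂` obeys the target shape of ROOT B with `κ = 16d²·αCst`, `C·L^{−k} = 16d²·Cst(2αCst + βCst)·L^{−k}` (every term by `ComponentSwapShift.perturbationLaws_siteMul_swap_mul`
on `shiftLaws_edgeTransl`; sums by `KroneckerUnits.perturbationLaws_finsetSum`). [folklore] -/
theorem perturbationLaws_deltaPrime₂ {α β : ℝ}
    (hF : ∀ μ ν jj, BoundedBackgroundM L M (zF L M c e V μ ν jj) α β) (hB : ∀ μ ν jj, BoundedBackgroundM L M (zB L M c e V μ ν jj) α β) :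
    PerturbationLaws (Dc L M a ha) (deltaPrime₂ L M c e V) (Jc L M)
      (∑ _q ∈ dirPairs d, ∑ _jj ∈ orderedPairs, ‖(1 / 2 : ℂ)‖ * (α * Cst d a + α * Cst d a))
      (fun k => ∑ _q ∈ dirPairs d, ∑ _jj ∈ orderedPairs, ‖(1 / 2 : ℂ)‖ *
        (Cst d a * (α * (2 * Cst d a) + β * Cst d a) * ((L : ℝ)⁻¹) ^ k + Cst d a * (α * (2 * Cst d a) + β * Cst d a) * ((L : ℝ)⁻¹) ^ k)) := by
  have h : PerturbationLaws (Dc L M a ha) (fun k => ∑ q ∈ dirPairs d, ∑ jj ∈ orderedPairs, (1 / 2 : ℂ) •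
      (siteMul (zF L M c e V q.1 q.2 jj k)
          * (cSwap L M (o := ι) (edgeSlot q.1 q.2 jj.1) (edgeSlot q.1 q.2 jj.2) k
            * transl (fine (lev L k) M) (edgeOff (fine (lev L k) M) q.1 q.2 jj.2 - edgeOff (fine (lev L k) M) q.1 q.2 jj.1) ⊗ₖ (1 : Matrix ι ι ℂ))
        + siteMul (zB L M c e V q.1 q.2 jj k)
          * (cSwap L M (o := ι) (edgeSlot q.1 q.2 jj.2) (edgeSlot q.1 q.2 jj.1) k
            * transl (fine (lev L k) M) (edgeOff (fine (lev L k) M) q.1 q.2 jj.1 - edgeOff (fine (lev L k) M) q.1 q.2 jj.2) ⊗ₖ (1 : Matrix ι ι ℂ))))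
      (Jc L M) _ _ :=
    perturbationLaws_finsetSum _ fun q _ => perturbationLaws_finsetSum _ fun jj _ =>
      perturbationLaws_smul _ (perturbationLaws_add
        (perturbationLaws_siteMul_swap_mul L M a ha (hF q.1 q.2 jj) _ _ (shiftLaws_edgeTransl L M a ha q.1 q.2 jj.1 jj.2))
        (perturbationLaws_siteMul_swap_mul L M a ha (hB q.1 q.2 jj) _ _ (shiftLaws_edgeTransl L M a ha q.1 q.2 jj.2 jj.1)))
  have hfun : deltaPrime₂ L M c e V = fun k => ∑ q ∈ dirPairs d, ∑ jj ∈ orderedPairs, (1 / 2 : ℂ) •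
      (siteMul (zF L M c e V q.1 q.2 jj k)
          * (cSwap L M (o := ι) (edgeSlot q.1 q.2 jj.1) (edgeSlot q.1 q.2 jj.2) k
            * transl (fine (lev L k) M) (edgeOff (fine (lev L k) M) q.1 q.2 jj.2 - edgeOff (fine (lev L k) M) q.1 q.2 jj.1) ⊗ₖ (1 : Matrix ι ι ℂ))
        + siteMul (zB L M c e V q.1 q.2 jj k)
          * (cSwap L M (o := ι) (edgeSlot q.1 q.2 jj.2) (edgeSlot q.1 q.2 jj.1) k
            * transl (fine (lev L k) M) (edgeOff (fine (lev L k) M) q.1 q.2 jj.1 - edgeOff (fine (lev L k) M) q.1 q.2 jj.2) ⊗ₖ (1 : Matrix ι ι ℂ))) :=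
    funext fun k => deltaPrime₂_eq L M c e V k
  rw [hfun]
  exact h

end Tower

/-! ## Size of the catalogue fields: `‖zF‖, ‖zB‖ ≤ b` from `‖B‖ ≤ b` (unitary bond fields, trace-orthonormal family) -/

section Size

open Summit.QuantumFields.BalabanUV.Beta.AdjointCarrierWiring (adMat_transpose_mul_self)
open Summit.QuantumFields.BalabanUV.Beta.AdjointCarrierWiringEnd (CompFamily)
open Summit.QuantumFields.BalabanUV.Beta.ThinLoopHolonomy (cpxHom norm_cpxHom_le_one)

variable {L : ℕ} [NeZero L] {M : Fin d → ℕ} [hM : ∀ μ, NeZero (M μ)] {c : ℝ} {Pc : Submodule ℝ (Matrix n n ℂ)} {e : ι → Matrix n n ℂ}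
  (hF : CompFamily c Pc e)

omit [Fintype n] [DecidableEq n] hNf in
/-- norm of a pair field: `‖Rlᵀ·B·Rr‖ ≤ b` whenever `‖Rlᵀ‖, ‖Rr‖ ≤ 1`, `‖B‖ ≤ b`, `0 ≤ b`. [folklore] -/
theorem norm_pairField_le {Rl B Rr : Tor Nf → Matrix ι ι ℂ} {δl : Tor Nf} {κl : Fin d} {b : ℝ} (hb : 0 ≤ b)
    (hl : ∀ x, ‖(Rl x)ᵀ‖ ≤ 1) (hBb : ∀ x, ‖B x‖ ≤ b) (hr : ∀ x, ‖Rr x‖ ≤ 1) (i : Tor Nf × Fin d) :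
    ‖pairField Nf Rl B Rr δl κl i‖ ≤ b := by
  unfold pairField
  split_ifs with h
  · calc ‖(Rl (i.1 - δl))ᵀ * B (i.1 - δl) * Rr (i.1 - δl)‖ ≤ ‖(Rl (i.1 - δl))ᵀ * B (i.1 - δl)‖ * ‖Rr (i.1 - δl)‖ := Matrix.l2_opNorm_mul _ _
      _ ≤ (1 * b) * 1 := mul_le_mul ((Matrix.l2_opNorm_mul _ _).trans (mul_le_mul (hl _) (hBb _) (norm_nonneg _) zero_le_one)) (hr _)
          (norm_nonneg _) (by positivity)
      _ = b := by ring
  · rw [norm_zero]; exact hb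

include hF in
/-- the adjoint colour matrix of a unitary is a contraction, and so is its transpose (real entries: `ᵀ = ᴴ`). [folklore] -/
theorem norm_adM_le_one {u : Matrix n n ℂ} (hu : u ∈ Matrix.unitaryGroup n ℂ) :
    ‖(adMat c e u).map ((↑) : ℝ → ℂ)‖ ≤ 1 ∧ ‖((adMat c e u).map ((↑) : ℝ → ℂ))ᵀ‖ ≤ 1 := by
  have h1 : ‖(adMat c e u).map ((↑) : ℝ → ℂ)‖ ≤ 1 :=
    norm_cpxHom_le_one _ (adMat_transpose_mul_self c Pc e hF.mem hF.compl hF.stable hF.orth hu)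
  refine ⟨h1, ?_⟩
  have hT : ((adMat c e u).map ((↑) : ℝ → ℂ))ᵀ = ((adMat c e u).map ((↑) : ℝ → ℂ))ᴴ := by
    ext k l; simp [Matrix.conjTranspose_apply, Matrix.transpose_apply]
  rw [hT, Matrix.l2_opNorm_conjTranspose]
  exact h1

omit hNf in
include hF in
/-- every signed edge matrix `edgeR j` and its transpose are contractions (unitary bond field). [folklore] -/
theorem norm_edgeR_le_one [Nonempty ι] {V : Fin d → Tor Nf → Matrix n n ℂ} (hV : ∀ μ x, V μ x ∈ Matrix.unitaryGroup n ℂ) (x : Tor Nf) (μ ν : Fin d)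
    (j : Fin 4) : ‖edgeR Nf c e V x μ ν j‖ ≤ 1 ∧ ‖(edgeR Nf c e V x μ ν j)ᵀ‖ ≤ 1 := by
  have hone : ‖(1 : Matrix ι ι ℂ)‖ ≤ 1 := by
    rw [Matrix.cstar_norm_def, map_one]; exact ContinuousLinearMap.norm_id_le
  fin_cases j
  · obtain ⟨h1, h2⟩ := norm_adM_le_one hF (hV ν x)
    exact ⟨by simpa [edgeR, norm_neg] using h1, by simpa [edgeR, Matrix.transpose_neg, norm_neg] using h2⟩
  · refine ⟨?_, ?_⟩
    · show ‖(-1 : Matrix ι ι ℂ)‖ ≤ 1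
      rw [norm_neg]; exact hone
    · show ‖(-1 : Matrix ι ι ℂ)ᵀ‖ ≤ 1
      rw [Matrix.transpose_neg, Matrix.transpose_one, norm_neg]; exact hone
  · refine ⟨?_, ?_⟩
    · show ‖(1 : Matrix ι ι ℂ)‖ ≤ 1
      exact hone
    · show ‖(1 : Matrix ι ι ℂ)ᵀ‖ ≤ 1
      rw [Matrix.transpose_one]; exact hone
  · exact norm_adM_le_one hF (hV μ x)

omit [NeZero L] hM in
include hF in
/-- **SIZE OF THE CATALOGUE FIELDS**: for a unitary bond-field tower and a plaquette-field bound `‖B_k(x)‖ ≤ b` (the (3.35)-shape on `cη²·Im U(∂p)` read through `brkF`),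
`‖zF … k i‖ ≤ b` and `‖zB … k i‖ ≤ b`. [folklore] -/
theorem norm_zF_zB_le [Nonempty ι] {V : (k : ℕ) → Fin d → Tor (fine (lev L k) M) → Matrix n n ℂ} (hV : ∀ k μ x, V k μ x ∈ Matrix.unitaryGroup n ℂ) {b : ℝ}
    (hb : 0 ≤ b) (hBb : ∀ k μ ν x, ‖Bfield (fine (lev L k) M) (lev L k) c e (V k) μ ν x‖ ≤ b) (μ ν : Fin d) (jj : Fin 4 × Fin 4) (k : ℕ)
    (i : idx L M k) : ‖zF L M c e V μ ν jj k i‖ ≤ b ∧ ‖zB L M c e V μ ν jj k i‖ ≤ b := by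
  refine ⟨norm_pairField_le _ hb (fun x => (norm_edgeR_le_one _ hF (hV k) x μ ν jj.1).2) (hBb k μ ν)
      (fun x => (norm_edgeR_le_one _ hF (hV k) x μ ν jj.2).1) i,
    norm_pairField_le _ hb (fun x => (norm_edgeR_le_one _ hF (hV k) x μ ν jj.2).2) (fun x => ?_)
      (fun x => (norm_edgeR_le_one _ hF (hV k) x μ ν jj.1).1) i⟩
  rw [Bfield, brkF_transpose, norm_neg]
  exact hBb k μ ν x

end Size

end Summit.QuantumFields.BalabanUV.T4Continuum.NE2.DeltaPrimeCatalogue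


end
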